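import Mathlib
import HarnessLib
import Summits.Ventures.LatticeQCDFlow.Scaling.GeneralLayerLagLaw

/-!
# GeneralLayerLagLawUniform — the lag law for ARBITRARY relaxation layers, II: along the uniform
# `n`-step protocol `|⟨W⟩ − ΔF − KL_qs| ≤ (θ/(1−θ))·σ̄²/n`, `θ = ρ·e^{ΔD/(2n)}`; with the floor,
# `⟨W⟩ − ΔF = (⟨D⟩_0 − ⟨D⟩_1)/(2n) ± [(θ/(1−θ))σ̄²/n + M₃/(12n²)]`; reversible layers: `ρ = λ⋆`

HONEST FRAMING: exact (Metropolis-corrected) sampling algorithms for lattice gauge theory;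
figures of merit are autocorrelation/cost numbers at stated couplings and volumes; no
continuum-physics claim.

Venture `LatticeQCDFlow` (cell pub-lqcd), topic `Scaling`; FANOUT row 19 (`su2-snf`, GEN-5).
OUR WORK (elementary), nothing here is cited as a fact.  Sequel of
`Scaling/GeneralLayerLagLaw.lean` (identity, lag bound, `χ²`-recursion, any-grid bound); setting
and notation as there (`layerDissipation = ⟨W⟩ − ΔF`, `KL_qs = qsDissipation`, `Var_c(D) = varD`,
`ChiSqContracts`, row 8's `lagSeq`).

* `lagSeq_le_lagSeq_of_le` — the lag sequence is monotone in the drops;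
  `abs_layerDissipation_sub_qs_le_of_steps` — ANY grid with steps `≤ h`:
  `|⟨W⟩ − ΔF − KL_qs| ≤ (θ_h/(1−θ_h))·h·σ̄²·Σ_j|c_{j+1} − c_j|` (tuned schedules: the largest step
  replaces `1/n`);
* **`abs_layerDissipation_uniform_sub_qs_le` — THE GENERAL-LAYER LAG LAW**: along `c_j = j/n`,
  if `|D x − D y| ≤ ΔD`, `Var_c(D) ≤ σ̄²`, every layer contracts `χ²` towards its target with
  `ρ ≥ 0` and `θ := ρ·e^{ΔD/(2n)} < 1`, then **`|⟨W⟩ − ΔF − KL_qs| ≤ (θ/(1−θ))·σ̄²/n`** — row 8's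
  lazy law `ε/(1−ε)·(⟨D⟩_0 − ⟨D⟩_1)/n` with `ε ↦ θ` and the drop
  `⟨D⟩_0 − ⟨D⟩_1 = ∫₀¹ Var_c(D) dc ↦ σ̄²`, for ANY layers and on BOTH sides; as `n → ∞`,
  `θ/(1−θ) → ρ/(1−ρ) = (2τ̄ − 1)/2` with `τ̄ = (1+ρ)/(2(1−ρ))` the integrated autocorrelation
  time of the slowest mode, so with the floor `≤ σ̄²/(2n)` the bound reads
  `⟨W⟩ − ΔF ≲ 2τ̄·σ̄²/(2n)` — the general-layer form of row 8's `2τ_int × FLOOR` and of E7's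
  `k′ = Δ²·2τ_int` reading (arXiv:2510.25704 §3.1; `Scaling/AR1SwitchingLaw` is the solvable
  model), here for the MEAN WORK;
* **`abs_marginal_mean_sub_gibbsMean_le`** — EVERY marginal is observably close to equilibrium:
  `|E_{μ_j}[O] − ⟨O⟩_{j/n}| ≤ (θ/(1−θ))·(σ̄/n)·√Var_{j/n}(O)` for every step `j` and observable `O`
  (`lagSeq_const_le_geom`: the lag saturates at `θd̄/(1−θ)`; `sqrt_chiSqDiv_evolveLaw_uniform_le`:
  `√χ²(μ_j ‖ π_{j/n}) ≤ (θ/(1−θ))σ̄/n` at every step).  Reading for the row's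
  planted-invalid control X-3 ("drop the reweighting"): its bias on endpoint observables is
  `O(σ̄σ_O/n_step)` and vanishes as the protocol is refined — undetectable by an observable-level
  `z`-test at production `n_step`; detection must use the weight/work identity;
* `layerDissipation_uniform_le_tauInt` — **`⟨W⟩ − ΔF ≤ 2τ̄·(σ̄²/2n) + M₃/(12n²)`**,
  `τ̄ = Scoring.tauInt (fun t => θ^t) = (1+θ)/(2(1−θ))`: the literal analogue of row 8's
  `lazyDissipation_uniform_le_tauInt`, for arbitrary layers;
* `layerDissipation_uniform_le_floor` / `floor_le_layerDissipation_uniform` — with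
  `|κ₃,c(D)| ≤ M₃` on `[0,1]` (row 8's `QuasiStaticSecondOrder`):
  `|⟨W⟩ − ΔF − (⟨D⟩_0 − ⟨D⟩_1)/(2n)| ≤ (θ/(1−θ))σ̄²/n + M₃/(12n²)`; the LOWER side says that
  over-relaxing / echo layers (which CAN dissipate less than the floor:
  `Scaling/AR1SwitchingEndpoints`, `ρ = −1`) never undercut it by more than the lag budget;
* instances: `chiSqDiv_stepLaw_lazyLayer` / `chiSqContracts_lazyLayer` (the lazy layer scales
  `χ²` by exactly `ε²`: row 8's class, coefficient `|ε|`), and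
  **`abs_layerDissipation_uniform_sub_qs_le_of_reversible`** — for stochastic layers reversible
  for their targets and irreducible, the law holds with `ρ = max_k λ⋆(P_k)` (one minus the
  absolute spectral gap, `1 − 1/t_rel`): NO laziness, monotonicity or positive-correlation
  hypothesis — heat-bath and Metropolis sweeps in palindromic order included.

NOT CLAIMED: the path-space ESS of general layers (the Gaussian-work dictionary
`−log ESS = Var W = 2(⟨W⟩ − ΔF)` is the AR(1) model's, `Scaling/AR1SwitchingJarzynski`); any value
of `ρ`, `σ̄`, `M₃` for a lattice kernel; sharpness — the law is an UPPER ENVELOPE: on a 3-state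
Metropolis toy (seat check, not filed) the true lag term is 3–15 % of `(θ/(1−θ))σ̄²/n` (slack:
`λ⋆` versus the mode the switch observable couples to, `σ̄²` versus the path variance, and
negative eigenvalues, whose dissipation benefit a `χ²`-norm cannot credit).  Printed
counterpart NAMED ONLY (not used, not restated): the near-equilibrium "excess power = friction ×
speed²" law with friction = variance × relaxation time of the conjugate force (Sivak–Crooks,
Phys. Rev. Lett. 108 (2012) 190602); the theorem here is a finite-state, discrete-time, two-sided
bound with no linear-response assumption.
-/

namespace Summit.Ventures.LatticeQCDFlow.Scaling

open Finset
open Literature.Probability.MarkovChains (IsRowStochastic stepLaw DetailedBalance IsIrreducible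
  lambdaStar lawVariance lawMean lambdaStar_nonneg)
open Literature.Probability.ImportanceSampling (chiSqDiv chiSqDiv_def chiSqDiv_eq_sum_sq_div)
open Summit.Ventures.LatticeQCDFlow.Exactness
open Summit.Ventures.LatticeQCDFlow.Theory2

variable {X : Type*} [Fintype X]

/-! ## The general-layer lag law along the uniform grid -/

/-- The lag sequence is monotone in the drops (`θ ≥ 0`). -/
theorem lagSeq_le_lagSeq_of_le {θ : ℝ} (hθ : 0 ≤ θ) {d d' : ℕ → ℝ} (h : ∀ k, d k ≤ d' k) :
    ∀ j, lagSeq θ d j ≤ lagSeq θ d' j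
  | 0 => le_rfl
  | j + 1 => by
      rw [lagSeq_succ, lagSeq_succ]
      exact mul_le_mul_of_nonneg_left (add_le_add (lagSeq_le_lagSeq_of_le hθ h j) (h j)) hθ

/-- **THE GENERAL-LAYER LAG LAW (uniform grid `c_j = j/n`).**  If `|D x − D y| ≤ ΔD`,
`Var_c(D) ≤ σ̄²` along the path, every layer `P k` contracts `χ²` towards its target
`π_{(k+1)/n}` with coefficient `ρ ≥ 0`, and `θ := ρ·e^{ΔD/(2n)} < 1`, then
`|⟨W⟩ − ΔF − KL_qs| ≤ (θ/(1 − θ))·σ̄²/n`. -/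
theorem abs_layerDissipation_uniform_sub_qs_le [Nonempty X] (S₀ D : X → ℝ)
    (P : ℕ → X → X → ℝ) (hP : ∀ k x, ∑ y, P k x y = 1) {n : ℕ} (hn : n ≠ 0) {ΔD ρ σbar : ℝ}
    (hD : ∀ x y, |D x - D y| ≤ ΔD)
    (hK : ∀ k, ChiSqContracts (P k) (gibbsLaw (linAction S₀ D (((k + 1 : ℕ) : ℝ) / n))) ρ)
    (hρ : 0 ≤ ρ) (hσ0 : 0 ≤ σbar) (hσ : ∀ c, varD S₀ D c ≤ σbar ^ 2)
    (hθ1 : ρ * Real.exp (ΔD / (2 * n)) < 1) :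
    |layerDissipation S₀ D (fun k => (k : ℝ) / n) P n
        - qsDissipation S₀ D (fun k => (k : ℝ) / n) n|
      ≤ (ρ * Real.exp (ΔD / (2 * n))) / (1 - ρ * Real.exp (ΔD / (2 * n))) * (σbar ^ 2 / n) := by
  set θ := ρ * Real.exp (ΔD / (2 * n)) with hθdef
  have hθ0 : 0 ≤ θ := by positivity
  have hn' : (0 : ℝ) < n := Nat.cast_pos.mpr (Nat.pos_of_ne_zero hn)
  have hδ : ∀ k : ℕ, |(((k + 1 : ℕ) : ℝ) / n) - (k : ℝ) / n| = 1 / n := by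
    intro k
    rw [succ_div_sub_div hn k, abs_of_pos (by positivity)]
  have hθk : ∀ k : ℕ, ρ * Real.exp (|(((k + 1 : ℕ) : ℝ) / n) - (k : ℝ) / n| * ΔD / 2) ≤ θ := by
    intro k
    rw [hδ k, hθdef, show 1 / (n : ℝ) * ΔD / 2 = ΔD / (2 * n) by field_simp]
  have hgen := abs_layerDissipation_sub_qs_le S₀ D (fun k => (k : ℝ) / n) P hP hD hK hρ hθk n
  -- the drops are at most `σ̄/n`
  have hsq : ∀ c, Real.sqrt (varD S₀ D c) ≤ σbar := fun c =>
    (Real.sqrt_le_sqrt (hσ c)).trans_eq (Real.sqrt_sq hσ0)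
  have hd : ∀ k : ℕ, |(((k + 1 : ℕ) : ℝ) / n) - (k : ℝ) / n| * Real.sqrt (varD S₀ D ((k : ℝ) / n))
      ≤ σbar / n := by
    intro k
    rw [hδ k, one_div_mul_eq_div]
    exact div_le_div_of_nonneg_right (hsq _) hn'.le
  have hd0 : ∀ k : ℕ,
      0 ≤ |(((k + 1 : ℕ) : ℝ) / n) - (k : ℝ) / n| * Real.sqrt (varD S₀ D ((k : ℝ) / n)) :=
    fun k => by positivity
  have hlag : ∀ j, lagSeq θ
        (fun k => |(((k + 1 : ℕ) : ℝ) / n) - (k : ℝ) / n| * Real.sqrt (varD S₀ D ((k : ℝ) / n))) j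
      ≤ lagSeq θ (fun _ => σbar / n) j := lagSeq_le_lagSeq_of_le hθ0 hd
  have hsumlag := sum_lagSeq_le hθ0 hθ1 (δ := fun _ => σbar / n) (fun _ => by positivity) n
  rw [sum_const, card_range, nsmul_eq_mul] at hsumlag
  have hterm : ∀ j ∈ range n,
      |(((j + 1 : ℕ) : ℝ) / n) - (j : ℝ) / n| * Real.sqrt (varD S₀ D ((j : ℝ) / n))
        * lagSeq θ (fun k => |(((k + 1 : ℕ) : ℝ) / n) - (k : ℝ) / n|
            * Real.sqrt (varD S₀ D ((k : ℝ) / n))) j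
      ≤ σbar / n * lagSeq θ (fun _ => σbar / n) j := fun j _ =>
    mul_le_mul (hd j) (hlag j) (lagSeq_nonneg hθ0 hd0 j) (by positivity)
  calc |layerDissipation S₀ D (fun k => (k : ℝ) / n) P n
          - qsDissipation S₀ D (fun k => (k : ℝ) / n) n|
      ≤ _ := hgen
    _ ≤ ∑ j ∈ range n, σbar / n * lagSeq θ (fun _ => σbar / n) j := sum_le_sum hterm
    _ = σbar / n * ∑ j ∈ range n, lagSeq θ (fun _ => σbar / n) j := by rw [mul_sum]
    _ ≤ σbar / n * (θ / (1 - θ) * ((n : ℝ) * (σbar / n))) :=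
        mul_le_mul_of_nonneg_left hsumlag (by positivity)
    _ = θ / (1 - θ) * (σbar ^ 2 / n) := by
        field_simp

/-- **With the certified floor (row 8's `QuasiStaticSecondOrder`), upper side**: if moreover
`|κ₃,c(D)| ≤ M₃` on `[0, 1]`, then
`⟨W⟩ − ΔF ≤ (⟨D⟩_0 − ⟨D⟩_1)/(2n) + (θ/(1−θ))·σ̄²/n + M₃/(12n²)`. -/
theorem layerDissipation_uniform_le_floor [Nonempty X] (S₀ D : X → ℝ)
    (P : ℕ → X → X → ℝ) (hP : ∀ k x, ∑ y, P k x y = 1) {n : ℕ} (hn : n ≠ 0) {ΔD ρ σbar M₃ : ℝ}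
    (hD : ∀ x y, |D x - D y| ≤ ΔD)
    (hK : ∀ k, ChiSqContracts (P k) (gibbsLaw (linAction S₀ D (((k + 1 : ℕ) : ℝ) / n))) ρ)
    (hρ : 0 ≤ ρ) (hσ0 : 0 ≤ σbar) (hσ : ∀ c, varD S₀ D c ≤ σbar ^ 2)
    (hθ1 : ρ * Real.exp (ΔD / (2 * n)) < 1)
    (hM : ∀ c ∈ Set.Icc (0:ℝ) 1, |kappa3D S₀ D c| ≤ M₃) :
    layerDissipation S₀ D (fun k => (k : ℝ) / n) P n
      ≤ (meanD S₀ D 0 - meanD S₀ D 1) / (2 * n)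
        + (ρ * Real.exp (ΔD / (2 * n))) / (1 - ρ * Real.exp (ΔD / (2 * n))) * (σbar ^ 2 / n)
        + M₃ / (12 * (n : ℝ) ^ 2) := by
  have h1 := (abs_le.mp (abs_layerDissipation_uniform_sub_qs_le S₀ D P hP hn hD hK hρ hσ0 hσ
    hθ1)).2
  have h2 := (abs_le.mp (abs_qsDissipation_uniform_sub_floor_le S₀ D hn hM)).2
  linarith

/-- **Lower side**: `⟨W⟩ − ΔF ≥ (⟨D⟩_0 − ⟨D⟩_1)/(2n) − (θ/(1−θ))·σ̄²/n − M₃/(12n²)` — even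
over-relaxing / echo layers cannot undercut the floor by more than the lag budget. -/
theorem floor_le_layerDissipation_uniform [Nonempty X] (S₀ D : X → ℝ)
    (P : ℕ → X → X → ℝ) (hP : ∀ k x, ∑ y, P k x y = 1) {n : ℕ} (hn : n ≠ 0) {ΔD ρ σbar M₃ : ℝ}
    (hD : ∀ x y, |D x - D y| ≤ ΔD)
    (hK : ∀ k, ChiSqContracts (P k) (gibbsLaw (linAction S₀ D (((k + 1 : ℕ) : ℝ) / n))) ρ)
    (hρ : 0 ≤ ρ) (hσ0 : 0 ≤ σbar) (hσ : ∀ c, varD S₀ D c ≤ σbar ^ 2)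
    (hθ1 : ρ * Real.exp (ΔD / (2 * n)) < 1)
    (hM : ∀ c ∈ Set.Icc (0:ℝ) 1, |kappa3D S₀ D c| ≤ M₃) :
    (meanD S₀ D 0 - meanD S₀ D 1) / (2 * n)
        - (ρ * Real.exp (ΔD / (2 * n))) / (1 - ρ * Real.exp (ΔD / (2 * n))) * (σbar ^ 2 / n)
        - M₃ / (12 * (n : ℝ) ^ 2)
      ≤ layerDissipation S₀ D (fun k => (k : ℝ) / n) P n := by
  have h1 := (abs_le.mp (abs_layerDissipation_uniform_sub_qs_le S₀ D P hP hn hD hK hρ hσ0 hσ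
    hθ1)).1
  have h2 := (abs_le.mp (abs_qsDissipation_uniform_sub_floor_le S₀ D hn hM)).1
  linarith

/-! ## The un-reweighted endpoint (the planted-invalid "drop the weights" control) -/

/-- Constant drops: the lag saturates at `θ d̄/(1 − θ)` (`0 ≤ θ < 1`, `d̄ ≥ 0`). -/
theorem lagSeq_const_le_geom {θ dbar : ℝ} (hθ0 : 0 ≤ θ) (hθ1 : θ < 1) (hd : 0 ≤ dbar) :
    ∀ j, lagSeq θ (fun _ => dbar) j ≤ θ / (1 - θ) * dbar
  | 0 => by simp only [lagSeq_zero]; exact mul_nonneg (div_nonneg hθ0 (sub_pos.mpr hθ1).le) hd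
  | j + 1 => by
      rw [lagSeq_succ]
      have ih := lagSeq_const_le_geom hθ0 hθ1 hd j
      have h1 : 0 < 1 - θ := sub_pos.mpr hθ1
      have key : θ * (θ / (1 - θ) * dbar + dbar) = θ / (1 - θ) * dbar := by
        field_simp
        ring
      calc θ * (lagSeq θ (fun _ => dbar) j + dbar) ≤ θ * (θ / (1 - θ) * dbar + dbar) :=
            mul_le_mul_of_nonneg_left (add_le_add ih le_rfl) hθ0
        _ = θ / (1 - θ) * dbar := key

/-- **Any grid with steps `≤ h`: `|⟨W⟩ − ΔF − KL_qs| ≤ (θ_h/(1−θ_h))·h·σ̄²·Σ_{j<n}|c_{j+1} − c_j|`**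
(`θ_h = ρ·e^{hΔD/2} ≤ θ < 1`; for a monotone grid from `0` to `1` the last factor is `1`, and with
`h = 1/n` this is the uniform law below): tuned, non-uniform schedules obey the same lag budget
with the LARGEST step in place of `1/n`. -/
theorem abs_layerDissipation_sub_qs_le_of_steps [Nonempty X] (S₀ D : X → ℝ) (c : ℕ → ℝ)
    (P : ℕ → X → X → ℝ) (hP : ∀ k x, ∑ y, P k x y = 1) {ΔD ρ σbar h θ : ℝ}
    (hD : ∀ x y, |D x - D y| ≤ ΔD)
    (hK : ∀ k, ChiSqContracts (P k) (gibbsLaw (linAction S₀ D (c (k + 1)))) ρ) (hρ : 0 ≤ ρ)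
    (hσ0 : 0 ≤ σbar) (hσ : ∀ x, varD S₀ D x ≤ σbar ^ 2) (hh : ∀ k, |c (k + 1) - c k| ≤ h)
    (hθ : ρ * Real.exp (h * ΔD / 2) ≤ θ) (hθ1 : θ < 1) (n : ℕ) :
    |layerDissipation S₀ D c P n - qsDissipation S₀ D c n|
      ≤ θ / (1 - θ) * (h * σbar ^ 2) * ∑ j ∈ range n, |c (j + 1) - c j| := by
  have hθ0 : 0 ≤ θ := le_trans (by positivity) hθ
  have hΔD0 : 0 ≤ ΔD := (abs_nonneg _).trans (hD (Classical.arbitrary X) (Classical.arbitrary X))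
  have hh0 : 0 ≤ h := (abs_nonneg _).trans (hh 0)
  have hθk : ∀ k, ρ * Real.exp (|c (k + 1) - c k| * ΔD / 2) ≤ θ := fun k =>
    (mul_le_mul_of_nonneg_left (Real.exp_le_exp.mpr (by
      have := hh k; nlinarith)) hρ).trans hθ
  have hgen := abs_layerDissipation_sub_qs_le S₀ D c P hP hD hK hρ hθk n
  have hsq : ∀ x, Real.sqrt (varD S₀ D x) ≤ σbar := fun x =>
    (Real.sqrt_le_sqrt (hσ x)).trans_eq (Real.sqrt_sq hσ0)
  have hd : ∀ k, |c (k + 1) - c k| * Real.sqrt (varD S₀ D (c k)) ≤ h * σbar := fun k =>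
    mul_le_mul (hh k) (hsq _) (Real.sqrt_nonneg _) hh0
  have hlag : ∀ j, lagSeq θ (fun k => |c (k + 1) - c k| * Real.sqrt (varD S₀ D (c k))) j
      ≤ θ / (1 - θ) * (h * σbar) := fun j =>
    (lagSeq_le_lagSeq_of_le hθ0 hd j).trans (lagSeq_const_le_geom hθ0 hθ1 (by positivity) j)
  refine hgen.trans ?_
  rw [mul_sum]
  refine sum_le_sum fun j _ => ?_
  have hd0 : 0 ≤ |c (j + 1) - c j| * Real.sqrt (varD S₀ D (c j)) := by positivity
  calc |c (j + 1) - c j| * Real.sqrt (varD S₀ D (c j))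
        * lagSeq θ (fun k => |c (k + 1) - c k| * Real.sqrt (varD S₀ D (c k))) j
      ≤ (|c (j + 1) - c j| * σbar) * (θ / (1 - θ) * (h * σbar)) :=
        mul_le_mul (mul_le_mul_of_nonneg_left (hsq _) (abs_nonneg _)) (hlag j)
          (lagSeq_nonneg hθ0 (fun k => by positivity) j) (by positivity)
    _ = θ / (1 - θ) * (h * σbar ^ 2) * |c (j + 1) - c j| := by ring

/-- **Uniform-grid `χ²` control of every marginal**: under the hypotheses of the general-layer
lag law, `√χ²(μ_j ‖ π_{j/n}) ≤ (θ/(1−θ))·σ̄/n` at EVERY step `j` (the lag recursion with constant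
drops `σ̄/n` saturates at `θ/(1−θ)` times the drop). -/
theorem sqrt_chiSqDiv_evolveLaw_uniform_le [Nonempty X] (S₀ D : X → ℝ)
    (P : ℕ → X → X → ℝ) (hP : ∀ k x, ∑ y, P k x y = 1) {n : ℕ} (hn : n ≠ 0) {ΔD ρ σbar : ℝ}
    (hD : ∀ x y, |D x - D y| ≤ ΔD)
    (hK : ∀ k, ChiSqContracts (P k) (gibbsLaw (linAction S₀ D (((k + 1 : ℕ) : ℝ) / n))) ρ)
    (hρ : 0 ≤ ρ) (hσ0 : 0 ≤ σbar) (hσ : ∀ c, varD S₀ D c ≤ σbar ^ 2)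
    (hθ1 : ρ * Real.exp (ΔD / (2 * n)) < 1) (j : ℕ) :
    Real.sqrt (chiSqDiv (evolveLaw P (gibbsLaw (linAction S₀ D 0)) j)
        (gibbsLaw (linAction S₀ D ((j : ℝ) / n))))
      ≤ (ρ * Real.exp (ΔD / (2 * n))) / (1 - ρ * Real.exp (ΔD / (2 * n))) * (σbar / n) := by
  set θ := ρ * Real.exp (ΔD / (2 * n)) with hθdef
  have hθ0 : 0 ≤ θ := by positivity
  have hn' : (0 : ℝ) < n := Nat.cast_pos.mpr (Nat.pos_of_ne_zero hn)
  have hδ : ∀ k : ℕ, |(((k + 1 : ℕ) : ℝ) / n) - (k : ℝ) / n| = 1 / n := by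
    intro k
    rw [succ_div_sub_div hn k, abs_of_pos (by positivity)]
  have hθk : ∀ k : ℕ, ρ * Real.exp (|(((k + 1 : ℕ) : ℝ) / n) - (k : ℝ) / n| * ΔD / 2) ≤ θ := by
    intro k
    rw [hδ k, hθdef, show 1 / (n : ℝ) * ΔD / 2 = ΔD / (2 * n) by field_simp]
  have hchi := sqrt_chiSqDiv_evolveLaw_le_lagSeq S₀ D (fun k => (k : ℝ) / n) P hP hD hK hρ hθk j
  simp only [Nat.cast_zero, zero_div] at hchi
  have hsq : ∀ c, Real.sqrt (varD S₀ D c) ≤ σbar := fun c =>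
    (Real.sqrt_le_sqrt (hσ c)).trans_eq (Real.sqrt_sq hσ0)
  have hd : ∀ k : ℕ, |(((k + 1 : ℕ) : ℝ) / n) - (k : ℝ) / n| * Real.sqrt (varD S₀ D ((k : ℝ) / n))
      ≤ σbar / n := by
    intro k
    rw [hδ k, one_div_mul_eq_div]
    exact div_le_div_of_nonneg_right (hsq _) hn'.le
  exact hchi.trans ((lagSeq_le_lagSeq_of_le hθ0 hd j).trans
    (lagSeq_const_le_geom hθ0 hθ1 (by positivity : 0 ≤ σbar / n) j))

/-- **EVERY marginal of the protocol is observably close to equilibrium:** along the uniform grid,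
under the hypotheses of the general-layer lag law, for every step `j` and EVERY observable `O`,
`|E_{μ_j}[O] − ⟨O⟩_{j/n}| ≤ (θ/(1−θ))·(σ̄/n)·√Var_{j/n}(O)`.  Reading for row 19's planted-invalid
control INVALID-3 / X-3 (CARD-su2-snf §3(c): weights dropped `w ≡ 1`, `ΔF := ⟨W⟩`): its bias on
any ENDPOINT OBSERVABLE is `O(σ̄·σ_O/n_step)` and VANISHES as the protocol is refined, so at
production `n_step` an observable-level `z`-test cannot see it, whereas its `ΔF` is off by exactly
the dissipation `⟨W⟩ − ΔF = (⟨D⟩_0 − ⟨D⟩_1)/(2n) ± …` (the floor theorems above): detection has to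
use the weight/work bookkeeping, as the row proposed (invariant `log w = −W + const`). -/
theorem abs_marginal_mean_sub_gibbsMean_le [Nonempty X] (S₀ D : X → ℝ)
    (P : ℕ → X → X → ℝ) (hP : ∀ k x, ∑ y, P k x y = 1) {n : ℕ} (hn : n ≠ 0) {ΔD ρ σbar : ℝ}
    (hD : ∀ x y, |D x - D y| ≤ ΔD)
    (hK : ∀ k, ChiSqContracts (P k) (gibbsLaw (linAction S₀ D (((k + 1 : ℕ) : ℝ) / n))) ρ)
    (hρ : 0 ≤ ρ) (hσ0 : 0 ≤ σbar) (hσ : ∀ c, varD S₀ D c ≤ σbar ^ 2)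
    (hθ1 : ρ * Real.exp (ΔD / (2 * n)) < 1) (O : X → ℝ) (j : ℕ) :
    |∑ y, evolveLaw P (gibbsLaw (linAction S₀ D 0)) j y * O y
        - gibbsMean (linAction S₀ D ((j : ℝ) / n)) O|
      ≤ (ρ * Real.exp (ΔD / (2 * n))) / (1 - ρ * Real.exp (ΔD / (2 * n))) * (σbar / n)
        * Real.sqrt (varLaw (gibbsLaw (linAction S₀ D ((j : ℝ) / n))) O) := by
  have hchi := sqrt_chiSqDiv_evolveLaw_uniform_le S₀ D P hP hn hD hK hρ hσ0 hσ hθ1 j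
  have hmass : ∑ y, evolveLaw P (gibbsLaw (linAction S₀ D 0)) j y = 1 := by
    rw [sum_evolveLaw P hP, sum_gibbsLaw]
  have hcs := abs_sum_mul_sub_sum_mul_le (gibbsLaw_pos (linAction S₀ D ((j : ℝ) / n))) hmass
    (sum_gibbsLaw _) O
  rw [lawVariance_eq_varLaw (sum_gibbsLaw _)] at hcs
  have hv0 : 0 ≤ Real.sqrt (varLaw (gibbsLaw (linAction S₀ D ((j : ℝ) / n))) O) :=
    Real.sqrt_nonneg _
  unfold gibbsMean
  exact hcs.trans (mul_le_mul_of_nonneg_right hchi hv0)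

/-! ## The `τ_int` form: dissipation `≤ 2τ̄ × (σ̄²/2n) + O(n⁻²)` -/

/-- The total equilibrium drop of the switch observable is at most the variance bound:
`⟨D⟩_0 − ⟨D⟩_1 ≤ σ̄²` (`d⟨D⟩_c/dc = −Var_c(D) ≥ −σ̄²`, mean value form). -/
theorem meanD_zero_sub_one_le [Nonempty X] (S₀ D : X → ℝ) {σbar : ℝ}
    (hσ : ∀ c, varD S₀ D c ≤ σbar ^ 2) : meanD S₀ D 0 - meanD S₀ D 1 ≤ σbar ^ 2 := by
  have hdiff : Differentiable ℝ (meanD S₀ D) := fun c => (hasDerivAt_meanD S₀ D c).differentiableAt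
  have hder : ∀ c, -σbar ^ 2 ≤ deriv (meanD S₀ D) c := fun c => by
    rw [(hasDerivAt_meanD S₀ D c).deriv]
    linarith [hσ c]
  have h := mul_sub_le_image_sub_of_le_deriv hdiff hder (show (0:ℝ) ≤ 1 by norm_num)
  linarith

/-- **THE LAG LAW AS A BOUND, general layers: `⟨W⟩ − ΔF ≤ 2τ̄ × (σ̄²/2n) + M₃/(12n²)`** with
`τ̄ = Scoring.tauInt (fun t => θ^t) = (1 + θ)/(2(1 − θ))`, `θ = ρ·e^{ΔD/(2n)}` — the exact
analogue of row 8's `lazyDissipation_uniform_le_tauInt` (`2τ_int × (⟨D⟩_0 − ⟨D⟩_1)/(2n) +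
M/(12n²)` for lazy layers), the drop replaced by its bound `σ̄²` and the laziness by the
`χ²`-contraction coefficient of ARBITRARY layers (`1/2` from the floor, `θ/(1−θ)` from the lag:
`1/2 + θ/(1−θ) = (1+θ)/(2(1−θ))`). -/
theorem layerDissipation_uniform_le_tauInt [Nonempty X] (S₀ D : X → ℝ)
    (P : ℕ → X → X → ℝ) (hP : ∀ k x, ∑ y, P k x y = 1) {n : ℕ} (hn : n ≠ 0) {ΔD ρ σbar M₃ : ℝ}
    (hD : ∀ x y, |D x - D y| ≤ ΔD)
    (hK : ∀ k, ChiSqContracts (P k) (gibbsLaw (linAction S₀ D (((k + 1 : ℕ) : ℝ) / n))) ρ)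
    (hρ : 0 ≤ ρ) (hσ0 : 0 ≤ σbar) (hσ : ∀ c, varD S₀ D c ≤ σbar ^ 2)
    (hθ1 : ρ * Real.exp (ΔD / (2 * n)) < 1)
    (hM : ∀ c ∈ Set.Icc (0:ℝ) 1, |kappa3D S₀ D c| ≤ M₃) :
    layerDissipation S₀ D (fun k => (k : ℝ) / n) P n
      ≤ 2 * Scoring.tauInt (fun t => (ρ * Real.exp (ΔD / (2 * n))) ^ t) * (σbar ^ 2 / (2 * n))
        + M₃ / (12 * (n : ℝ) ^ 2) := by
  set θ := ρ * Real.exp (ΔD / (2 * n)) with hθdef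
  have hθ0 : 0 ≤ θ := by positivity
  have h1 := layerDissipation_uniform_le_floor S₀ D P hP hn hD hK hρ hσ0 hσ hθ1 hM
  have hdrop := meanD_zero_sub_one_le S₀ D hσ
  have hn' : (0 : ℝ) < n := Nat.cast_pos.mpr (Nat.pos_of_ne_zero hn)
  have hfloor : (meanD S₀ D 0 - meanD S₀ D 1) / (2 * n) ≤ σbar ^ 2 / (2 * n) :=
    div_le_div_of_nonneg_right hdrop (by positivity)
  rw [Scoring.tauInt_geometric (abs_lt.mpr ⟨by linarith, hθ1⟩)]
  have hθ' : (1 - θ) ≠ 0 := (sub_pos.mpr hθ1).ne'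
  have key : σbar ^ 2 / (2 * n) + θ / (1 - θ) * (σbar ^ 2 / n)
      = 2 * ((1 + θ) / (2 * (1 - θ))) * (σbar ^ 2 / (2 * n)) := by
    field_simp
    ring
  linarith

/-! ## Instances: lazy layers (exact coefficient `|ε|`), reversible irreducible layers (`λ⋆`) -/

/-- The lazy layer `ε·I + (1 − ε)·Π` scales `χ²` by EXACTLY `ε²` … -/
theorem chiSqDiv_stepLaw_lazyLayer [DecidableEq X] (π : X → ℝ) (ε : ℝ) {μ : X → ℝ}
    (hμ : ∑ x, μ x = 1) : chiSqDiv (stepLaw (lazyLayer π ε) μ) π = ε ^ 2 * chiSqDiv μ π := by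
  rw [chiSqDiv_eq_sum_sq_div, chiSqDiv_eq_sum_sq_div, mul_sum]
  refine sum_congr rfl fun y _ => ?_
  rw [stepLaw_lazyLayer π ε hμ y]
  rw [show ε * μ y + (1 - ε) * π y - π y = ε * (μ y - π y) by ring, mul_pow, mul_div_assoc]

/-- … so it contracts `χ²` with coefficient `|ε|`: the general-layer law specialises to row 8's
lazy class with `θ = |ε|·e^{ΔD/(2n)}` (row 8's exact law has `ε/(1−ε)` and the drop
`⟨D⟩_0 − ⟨D⟩_1` in place of `θ/(1−θ)` and `σ̄²`). -/
theorem chiSqContracts_lazyLayer [DecidableEq X] (π : X → ℝ) (ε : ℝ) :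
    ChiSqContracts (lazyLayer π ε) π |ε| := fun μ hμ => by
  rw [chiSqDiv_stepLaw_lazyLayer π ε hμ, sq_abs]

/-- **REVERSIBLE IRREDUCIBLE LAYERS** (heat bath, Metropolis, their palindromic sweeps …): if each
`P k` is stochastic, reversible for its target `π_{(k+1)/n}`, irreducible, and
`λ⋆(P k) ≤ ρ` (one minus the absolute spectral gap; `ρ = 1 − 1/max_k t_rel(P k)`), then the
general-layer lag law holds with that `ρ` — NO laziness, monotonicity or positive-correlation
hypothesis. -/
theorem abs_layerDissipation_uniform_sub_qs_le_of_reversible [Nonempty X] [DecidableEq X]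
    (S₀ D : X → ℝ) (P : ℕ → X → X → ℝ) {n : ℕ} (hn : n ≠ 0) {ΔD ρ σbar : ℝ}
    (hD : ∀ x y, |D x - D y| ≤ ΔD) (hP : ∀ k, IsRowStochastic (P k))
    (hDB : ∀ k, DetailedBalance (gibbsLaw (linAction S₀ D (((k + 1 : ℕ) : ℝ) / n))) (P k))
    (hirr : ∀ k, IsIrreducible (P k)) (hlam : ∀ k, lambdaStar (P k) ≤ ρ)
    (hσ0 : 0 ≤ σbar) (hσ : ∀ c, varD S₀ D c ≤ σbar ^ 2)
    (hθ1 : ρ * Real.exp (ΔD / (2 * n)) < 1) :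
    |layerDissipation S₀ D (fun k => (k : ℝ) / n) P n
        - qsDissipation S₀ D (fun k => (k : ℝ) / n) n|
      ≤ (ρ * Real.exp (ΔD / (2 * n))) / (1 - ρ * Real.exp (ΔD / (2 * n))) * (σbar ^ 2 / n) := by
  have hρ : 0 ≤ ρ := (lambdaStar_nonneg (P 0)).trans (hlam 0)
  refine abs_layerDissipation_uniform_sub_qs_le S₀ D P (fun k => (hP k).2) hn hD (fun k => ?_)
    hρ hσ0 hσ hθ1
  exact (chiSqContracts_of_reversible (gibbsLaw_pos _) (sum_gibbsLaw _) (hP k) (hDB k)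
    (hirr k)).mono (fun x => (gibbsLaw_pos _ x).le) (lambdaStar_nonneg _) (hlam k)

end Summit.Ventures.LatticeQCDFlow.Scaling
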